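import Summits.BirchSwinnertonDyer.BirchSwinnertonDyer.Theorems.ByReductionTypeAtTwoSupersingularColemanRoad
import HarnessLib

/-!
# Route `ByReductionTypeAtTwo` (rung K4), crux `SupersingularRankZeroAtTwo` (item
# stmt-BirchSwinnertonDyer-19097), line `signed_halves_two` v3: THE COLEMAN ROAD at the line and class
# level — stub (4) VERBATIM, the certificate-fed door, and the crux BY NAME (seat `bsd-2adic-ss-1`, GEN 7)

HONEST FRAMING (cell `bsd-2adic`, run/shared/lean/pub/bsd-2adic/, HUMAN RULINGS D-0036/D-0059/D-0074):
THEOREMS ONLY; every research input an explicit hypothesis; no definition, no named fact, no instance,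
nothing booked; BSD is not proved by any of this. PARTITION (D-0054): X5@2 good-supersingular, `a₂ = 0`
sub-row (B1·O1; 208 rank-`0` classes) × `p = 2` — types-the-object-of; closes none. Companion of
`…SupersingularColemanRoad.lean` (same seat and GEN: the module theory — stub (4) AT THE DATUM / AT THE
CURVE from `Kato2004.thm12_4` + the Coleman–Kato package at `2`; the package is documented field by
field in that file's module docstring). The registered skeleton v3 is NOT reshaped here.

* §3 `zeroSignedUpper_of_colemanKatoAtTwo` — THE REGISTERED SIGNATURE of `stub_zeroSignedUpper`
  VERBATIM from `Kato2004.thm12_4` (accepted named fact, any `p`) and the ∀-closed package (Kobayashi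
  Thm. 6.2 (6.13) / 6.3 / 7.3 i) (7.21) / Cor. 7.2 + Kato Thm. 12.5 (4) ∘ Prop. 7.1 ii), READ AT `2`, on
  the pinned `IwasawaH1Data` / `FineSelmerDualData` / `SignedSelmerDualData`).
* §4 `bsdp_two_of_colemanKato_of_pow_dvd` — per curve: PUB {modularity, GZK, Kato 12.4} + {Kobayashi
  1.2@2, Kim 3.15@2} + the package at the curve + the descent certificate (`#Ш_an = q`, `v₂ q ≤ m`,
  `2^m ∣ #Ш`) ⇒ `BSDp W 2 ∧ KobayashiMainConjecture W 2 1` (p450683's door, `hup` discharged).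
* §5 `supersingularRankZeroAtTwo_of_line_colemanKato` — the crux BY NAME from stubs (1)(2)(3)(5) with
  stub (4) replaced by Kato 12.4 + the package (p434732's composition through §3).

References: [Kobayashi2003] Thm. 1.2, 4.1, 6.2, 6.3, Prop. 7.1, Cor. 7.2, Thm. 7.3; [Kato2004Asterisque]
Thm. 12.4, 12.5, §17.13; [BDKim2013] Cor. 3.15; [Miller2011LMS] Def. 1.1; [KuriharaOtsuki2006] pp. 557, 564.
-/

set_option autoImplicit false
-- the Theorems namespace of this sub repeats the summit name by design (D-0017 nested layout)
set_option linter.dupNamespace false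

noncomputable section

open scoped Classical MatrixGroups ModularForm

open CongruenceSubgroup WeierstrassCurve Literature.NumberTheory.EllipticCurves
  Literature.NumberTheory.EllipticCurves.ModularForms Literature.NumberTheory.EllipticCurves.Sprung2017
  Literature.NumberTheory.EllipticCurves.Rank1Residual Literature.NumberTheory.EllipticCurves.Rank1Residual.Typed
  Literature.NumberTheory.EllipticCurves.Kobayashi2003 Literature.NumberTheory.EllipticCurves.IwasawaDual
  ZpExtension Summit.BirchSwinnertonDyer.Rank1Residual Summit.BirchSwinnertonDyer.Rank1Residual.Supersingular

namespace Summit.BirchSwinnertonDyer.BirchSwinnertonDyer.Theorems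

namespace SSColemanRoad

/-! ## §3 ∀-closed: the registered signature of `stub_zeroSignedUpper` from the ∀-closed package -/

/-- **`stub_zeroSignedUpper` (line `signed_halves_two` v3, crux 19097) — its REGISTERED SIGNATURE
VERBATIM — from `Kato2004.thm12_4` and the ∀-closed Coleman–Kato package at `2`** on the `a₂ = 0`
rank-`0` sub-row (the package of `signedUpperDivisibility_two_of_colemanKato` for every curve of the
sub-row). So stub (4) of the line reads, after this theorem: Kato Thm. 12.4 (accepted named fact, any
`p`) + {Kobayashi Thm. 6.2 (6.13), Thm. 6.3, Thm. 7.3 i) (7.21), Cor. 7.2, Kato Thm. 12.5 (4) ∘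
Prop. 7.1 ii)} READ AT `2` — four printed statements composed by PROVED module theory.
[cite: Kobayashi2003, Thm. 4.1 (p. 8) and §7 (pp. 12–13)] [cite: Kato2004Asterisque, Thm. 12.4–12.5 (pp. 221–222)] -/
theorem zeroSignedUpper_of_colemanKatoAtTwo (h124 : Kato2004.thm12_4)
    (hCK : ∀ (W : WeierstrassCurve ℚ) [W.IsElliptic] [W.IsGloballyMinimal],
      ¬ W.HasCM → W.analyticRank = 0 → GoodSS W 2 → W.frobeniusTrace 2 = 0 →
      ∀ (κ : ZpExtension ℚ 2) (γ : Field.absoluteGaloisGroup ℚ),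
        κ.IsCyclotomic → κ.IsTopGenerator γ → IsCyclotomicVariable 2 γ →
        ∀ [NeZero (W.conductorNorm ℤ)] (f : CuspForm (Gamma0 (W.conductorNorm ℤ)) 2),
          IsNewformOf W f → ∀ (ϖ : ℚ), (ϖ : ℝ) * W.realPeriodRat = plusPeriod f →
        ∀ (Lplus Lminus : IwasawaAlgebra 2), IsPollackPair f 2 Lplus Lminus →
        ∀ (D : SignedSelmerDualData W κ γ 1) [ContinuousSMul ℤ_[2] (W.tateModule 2)],
          ∃ (I : Kato2004.IwasawaH1Data W 2 κ γ) (Y : W.FineSelmerDualData κ γ)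
            (P : Submodule (IwasawaAlgebra 2) (IwasawaAlgebra 2))
            (loc : I.H →ₗ[IwasawaAlgebra 2] P) (toX : P →ₗ[IwasawaAlgebra 2] D.X)
            (δ : D.X →ₗ[IwasawaAlgebra 2] Y.X) (Z : Submodule (IwasawaAlgebra 2) I.H)
            (G : IwasawaAlgebra 2),
            Function.Exact loc toX ∧ Function.Exact toX δ ∧
            Module.IsTorsion (IwasawaAlgebra 2) Y.X ∧
            G ∈ Submodule.map (P.subtype ∘ₗ loc) Z ∧
            iwasawaToPowerSeries 2 G =
              PowerSeries.C (ϖ : ℚ_[2]) * iwasawaToPowerSeries 2 (kobayashiL 1 Lplus Lminus) ∧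
            ∀ 𝔭 : PrimeSpectrum (IwasawaAlgebra 2), 𝔭.asIdeal.height = 1 →
              Literature.NumberTheory.EllipticCurves.Module.lengthAt (IwasawaAlgebra 2) Y.X 𝔭 ≤
                Literature.NumberTheory.EllipticCurves.Module.lengthAt (IwasawaAlgebra 2)
                  (I.H ⧸ Z) 𝔭) :
    ∀ (W : WeierstrassCurve ℚ) [W.IsElliptic] [W.IsGloballyMinimal],
      ¬ W.HasCM → W.analyticRank = 0 → GoodSS W 2 → W.frobeniusTrace 2 = 0 →
      ∀ (κ : ZpExtension ℚ 2) (γ : Field.absoluteGaloisGroup ℚ),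
        κ.IsCyclotomic → κ.IsTopGenerator γ → IsCyclotomicVariable 2 γ →
        ∀ [NeZero (W.conductorNorm ℤ)] (f : CuspForm (Gamma0 (W.conductorNorm ℤ)) 2),
          IsNewformOf W f → ∀ (ϖ : ℚ), (ϖ : ℝ) * W.realPeriodRat = plusPeriod f →
        ∀ (Lplus Lminus : IwasawaAlgebra 2), IsPollackPair f 2 Lplus Lminus →
        ∀ (D : SignedSelmerDualData W κ γ 1),
          ∃ g h : IwasawaAlgebra 2, D.charIdeal = Ideal.span {g} ∧
            iwasawaToPowerSeries 2 (g * h) =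
              PowerSeries.C (ϖ : ℚ_[2]) * iwasawaToPowerSeries 2 (kobayashiL 1 Lplus Lminus) :=
  fun W _ _ hcm hr hss ha ↦
    signedUpperDivisibility_two_of_colemanKato h124 (hCK W hcm hr hss ha)

/-! ## §4 Class level: BSD₂ and the even main conjecture at `2`, per curve, on the Coleman road -/

section ClassLevel

variable (W : WeierstrassCurve ℚ) [W.IsElliptic] [W.IsGloballyMinimal]

/-- **THE `a₂ = 0` DOOR ON THE COLEMAN ROAD (per curve; certificate-fed).** For `E = W` with good
reduction at `2`, `a₂ = 0`, `L(E,1) ≠ 0`: PUB {modularity `hmod`, GZK `hGZK`, Kato Thm. 12.4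
`h124` (accepted named fact, any `p`)} + {Kobayashi Thm. 1.2 at `2` (`h12`) and Kim Cor. 3.15 at `2`
(`hKim`) — both follow from the line's stub (2), `signedTorsion_two_of_eulerChar` /
`signedKim_two_of_eulerChar`} + THE COLEMAN–KATO PACKAGE AT `W` (`hCK`, module docstring) + the
descent CERTIFICATE (`#Ш_an = q`, `v₂ q ≤ m`, `2^m ∣ #Ш`; eng-2 CERT-CT2-X5ALL shape) ⇒
`BSD(E, 2)` AND `KobayashiMainConjecture W 2 1`. This is p450683's `bsdp_two_of_upper_of_pow_dvd`
with its binder `hup` (stub (4) at `W`) DISCHARGED by `signedUpperDivisibility_two_of_colemanKato`.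
[cite: Kobayashi2003, Thm. 1.2, Thm. 4.1, §7 and Conjecture (p. 2)] [cite: BDKim2013, Cor. 3.15]
[cite: Kato2004Asterisque, Thm. 12.4–12.5] [cite: Miller2011LMS, Def. 1.1] -/
theorem bsdp_two_of_colemanKato_of_pow_dvd
    (hmod : nonempty_modularParametrizationData)
    (hGZK : rank_eq_analyticRank_of_analyticRank_le_one)
    (h124 : Kato2004.thm12_4)
    (hgood : W.HasGoodReductionAtPrime 2) (ha : W.frobeniusTrace 2 = 0)
    (hL : W.entireLFunction 1 ≠ 0)
    (h12 : ∀ (κ : ZpExtension ℚ 2) (γ : Field.absoluteGaloisGroup ℚ),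
      κ.IsCyclotomic → κ.IsTopGenerator γ →
      ∀ D : SignedSelmerDualData W κ γ 1,
        Module.Finite (IwasawaAlgebra 2) D.X ∧ Module.IsTorsion (IwasawaAlgebra 2) D.X)
    (hKim : ∀ (κ : ZpExtension ℚ 2) (γ : Field.absoluteGaloisGroup ℚ),
      κ.IsCyclotomic → κ.IsTopGenerator γ →
      ∀ (D : SignedSelmerDualData W κ γ 1) [Module.Finite (IwasawaAlgebra 2) D.X],
        Module.IsTorsion (IwasawaAlgebra 2) D.X →
      ∀ g : IwasawaAlgebra 2, D.charIdeal = Ideal.span {g} → Finite (W.selmerGroupPInfty 2) →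
        ∃ u : ℤ_[2]ˣ, ((PowerSeries.constantCoeff g : ℤ_[2]) : ℚ_[2]) =
          ((u : ℤ_[2]) : ℚ_[2]) * ((2 : ℕ) : ℚ_[2]) ^ (padicValNat 2 W.tamagawaProduct) *
            (Nat.card (W.selmerGroupPInfty 2) : ℚ_[2]))
    (hCK : ∀ (κ : ZpExtension ℚ 2) (γ : Field.absoluteGaloisGroup ℚ),
      κ.IsCyclotomic → κ.IsTopGenerator γ → IsCyclotomicVariable 2 γ →
      ∀ [NeZero (W.conductorNorm ℤ)] (f : CuspForm (Gamma0 (W.conductorNorm ℤ)) 2),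
        IsNewformOf W f → ∀ (ϖ : ℚ), (ϖ : ℝ) * W.realPeriodRat = plusPeriod f →
      ∀ (Lplus Lminus : IwasawaAlgebra 2), IsPollackPair f 2 Lplus Lminus →
      ∀ (D : SignedSelmerDualData W κ γ 1) [ContinuousSMul ℤ_[2] (W.tateModule 2)],
        ∃ (I : Kato2004.IwasawaH1Data W 2 κ γ) (Y : W.FineSelmerDualData κ γ)
          (P : Submodule (IwasawaAlgebra 2) (IwasawaAlgebra 2))
          (loc : I.H →ₗ[IwasawaAlgebra 2] P) (toX : P →ₗ[IwasawaAlgebra 2] D.X)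
          (δ : D.X →ₗ[IwasawaAlgebra 2] Y.X) (Z : Submodule (IwasawaAlgebra 2) I.H)
          (G : IwasawaAlgebra 2),
          Function.Exact loc toX ∧ Function.Exact toX δ ∧
          Module.IsTorsion (IwasawaAlgebra 2) Y.X ∧
          G ∈ Submodule.map (P.subtype ∘ₗ loc) Z ∧
          iwasawaToPowerSeries 2 G =
            PowerSeries.C (ϖ : ℚ_[2]) * iwasawaToPowerSeries 2 (kobayashiL 1 Lplus Lminus) ∧
          ∀ 𝔭 : PrimeSpectrum (IwasawaAlgebra 2), 𝔭.asIdeal.height = 1 →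
            Literature.NumberTheory.EllipticCurves.Module.lengthAt (IwasawaAlgebra 2) Y.X 𝔭 ≤
              Literature.NumberTheory.EllipticCurves.Module.lengthAt (IwasawaAlgebra 2) (I.H ⧸ Z) 𝔭)
    {q : ℚ} (hq : shaAn W = (q : ℂ)) {m : ℕ} (hv : padicValRat 2 q ≤ m)
    (hdvd : 2 ^ m ∣ W.shaOrder) : BSDp W 2 ∧ KobayashiMainConjecture W 2 1 :=
  bsdp_two_of_upper_of_pow_dvd W hmod hGZK hgood ha hL h12 hKim
    (signedUpperDivisibility_two_of_colemanKato h124 hCK) hq hv hdvd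

end ClassLevel


/-! ## §5 The crux BY NAME: line `signed_halves_two` with stub (4) replaced by the Coleman road -/

/-- **Crux `SupersingularRankZeroAtTwo` from stubs (1)(2)(3)(5) of line `signed_halves_two` v3 (their
REGISTERED signatures verbatim: `hPub` = `stub_ssPub`, `hEC` = `stub_zeroSignedEulerChar`, `hlow` =
`stub_zeroKobayashiLower`, `hTwo` = `stub_traceTwoMillerHalves`) with stub (4) REPLACED by
`Kato2004.thm12_4` (accepted named fact, any `p`) + the ∀-closed Coleman–Kato package at `2` (`hCK`)** —
the landed composition `supersingularRankZeroAtTwo_of_line_eulerChar` (p434732) fed through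
`zeroSignedUpper_of_colemanKatoAtTwo`. A composition the planner may register as line v4 (same five
slots; slot (4) = the package); nothing is re-registered by this file.
[cite: Kobayashi2003, Thm. 1.2, Thm. 4.1, §7 and Conjecture (p. 2)] [cite: BDKim2013, Thm. 1.1 and Cor. 3.15]
[cite: Kato2004Asterisque, Thm. 12.4–12.5 (pp. 221–222)] [cite: Miller2011LMS, Def. 1.1] -/
theorem supersingularRankZeroAtTwo_of_line_colemanKato (h124 : Kato2004.thm12_4)
    (hPub : nonempty_modularParametrizationData ∧ rank_eq_analyticRank_of_analyticRank_le_one)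
    (hEC : ∀ (W : WeierstrassCurve ℚ) [W.IsElliptic] [W.IsGloballyMinimal],
        ¬ W.HasCM → W.analyticRank = 0 → GoodSS W 2 → W.frobeniusTrace 2 = 0 →
        ∀ (κ : ZpExtension ℚ 2) (γ : Field.absoluteGaloisGroup ℚ),
          κ.IsCyclotomic → κ.IsTopGenerator γ → Finite (W.selmerGroupPInfty 2) →
          Finite (endInvariants (conjSignedSelmerInfty W κ 1 γ - 1)) ∧
            ∃ u : ℤ_[2]ˣ, (Nat.card (endInvariants (conjSignedSelmerInfty W κ 1 γ - 1)) : ℚ_[2]) =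
              ((u : ℤ_[2]) : ℚ_[2]) * ((2 : ℕ) : ℚ_[2]) ^ (padicValNat 2 W.tamagawaProduct) *
                (Nat.card (W.selmerGroupPInfty 2) : ℚ_[2]) *
                  (Nat.card (EndCoinvariants (conjSignedSelmerInfty W κ 1 γ - 1)) : ℚ_[2]))
    (hlow : ∀ (W : WeierstrassCurve ℚ) [W.IsElliptic] [W.IsGloballyMinimal],
      ¬ W.HasCM → W.analyticRank = 0 → GoodSS W 2 → W.frobeniusTrace 2 = 0 →
        KobayashiLowerDivisibility W 2 1)
    (hCK : ∀ (W : WeierstrassCurve ℚ) [W.IsElliptic] [W.IsGloballyMinimal],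
      ¬ W.HasCM → W.analyticRank = 0 → GoodSS W 2 → W.frobeniusTrace 2 = 0 →
      ∀ (κ : ZpExtension ℚ 2) (γ : Field.absoluteGaloisGroup ℚ),
        κ.IsCyclotomic → κ.IsTopGenerator γ → IsCyclotomicVariable 2 γ →
        ∀ [NeZero (W.conductorNorm ℤ)] (f : CuspForm (Gamma0 (W.conductorNorm ℤ)) 2),
          IsNewformOf W f → ∀ (ϖ : ℚ), (ϖ : ℝ) * W.realPeriodRat = plusPeriod f →
        ∀ (Lplus Lminus : IwasawaAlgebra 2), IsPollackPair f 2 Lplus Lminus →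
        ∀ (D : SignedSelmerDualData W κ γ 1) [ContinuousSMul ℤ_[2] (W.tateModule 2)],
          ∃ (I : Kato2004.IwasawaH1Data W 2 κ γ) (Y : W.FineSelmerDualData κ γ)
            (P : Submodule (IwasawaAlgebra 2) (IwasawaAlgebra 2))
            (loc : I.H →ₗ[IwasawaAlgebra 2] P) (toX : P →ₗ[IwasawaAlgebra 2] D.X)
            (δ : D.X →ₗ[IwasawaAlgebra 2] Y.X) (Z : Submodule (IwasawaAlgebra 2) I.H)
            (G : IwasawaAlgebra 2),
            Function.Exact loc toX ∧ Function.Exact toX δ ∧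
            Module.IsTorsion (IwasawaAlgebra 2) Y.X ∧
            G ∈ Submodule.map (P.subtype ∘ₗ loc) Z ∧
            iwasawaToPowerSeries 2 G =
              PowerSeries.C (ϖ : ℚ_[2]) * iwasawaToPowerSeries 2 (kobayashiL 1 Lplus Lminus) ∧
            ∀ 𝔭 : PrimeSpectrum (IwasawaAlgebra 2), 𝔭.asIdeal.height = 1 →
              Literature.NumberTheory.EllipticCurves.Module.lengthAt (IwasawaAlgebra 2) Y.X 𝔭 ≤
                Literature.NumberTheory.EllipticCurves.Module.lengthAt (IwasawaAlgebra 2)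
                  (I.H ⧸ Z) 𝔭)
    (hTwo : (∀ (W : WeierstrassCurve ℚ) [W.IsElliptic] [W.IsGloballyMinimal],
        ¬ W.HasCM → W.analyticRank = 0 → GoodSS W 2 →
          (W.frobeniusTrace 2 = 2 ∨ W.frobeniusTrace 2 = -2) → MissingLowerBoundAt W 2) ∧
      (∀ (W : WeierstrassCurve ℚ) [W.IsElliptic] [W.IsGloballyMinimal],
        ¬ W.HasCM → W.analyticRank = 0 → GoodSS W 2 →
          (W.frobeniusTrace 2 = 2 ∨ W.frobeniusTrace 2 = -2) → MissingUpperBoundAt W 2)) :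
    Summit.BirchSwinnertonDyer.BirchSwinnertonDyer.Theses.ByReductionTypeAtTwo.SupersingularRankZeroAtTwo :=
  supersingularRankZeroAtTwo_of_line_eulerChar hPub hEC hlow (zeroSignedUpper_of_colemanKatoAtTwo h124 hCK)
    hTwo

end SSColemanRoad

end Summit.BirchSwinnertonDyer.BirchSwinnertonDyer.Theorems

end
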